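import Mathlib
import HarnessLib
import HarnessLib.Audit
import Summits.AtomisticToContinuum.Statement
import Literature.MathematicalPhysics.KineticTheory.InfiniteChainDynamics
import Literature.MathematicalPhysics.KineticTheory.LangevinChainNESS
import Summits.AtomisticToContinuum.FouriersLaw.Theorems.EmbeddedDrudeMourreNessUnique
import Summits.AtomisticToContinuum.FouriersLaw.Theorems.FourierGreenKuboFourierFiniteResponseOfUnique

/-!
Route: SelfDephasing

CLOSED (retired) 2026-08-15T13:46:36Z by operator:999:1257524 — reason: not-a-thesis: assembly does not conclude the sub-problem Statement — note: D-0027 §2.1 audit (human 2026-08-15: routes that do not decide the summit are removed): the assembly concludes `Literature.MathematicalPhysics.KineticTheory.HeatConduction.FouriersLaw`, not the sub-problem statement; a NEW conforming route may be opened from the same idea (generated `closes : … → _r. The file is kept as the record of this route; refuted decls are indexed as negative knowledge (`ledger negatives`).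

# Route SelfDephasing — bulk self-dephasing — Green–Kubo through the one-phonon L² lifetime
(dephasing-limited transport in the chain's own dynamic disorder)

X (BULK SELF-DEPHASING; realises card tangent-flow-self-dephasing, made intrinsic): for pinnedChain
ω₂ lam β γ (all four > 0) and
every T > 0 there is an infinite-volume Gibbs dynamics — a DLR Gibbs state μ_T (IsChainGibbsMeasure)
and a μ_T-preserving dynamics D
(InfiniteChainDynamics, PreservesMeasure) with absolutely convergent current correlations at every
time — such that
(SD1, OnePhononL2Decay) the ONE-PHONON BLOCK G_ab(x,t) := ∫ a_0 · (b_x∘φ_t) dμ_T, a,b ∈ {q,p} —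
equal, by Gaussian integration by
parts in p_0, to T × the Gibbs-averaged TANGENT-FLOW matrix elements ∂(q_x,p_x)(t)/∂p_0 and their
time-antiderivatives (the card's
"linear response = averaged tangent flow") — is square-integrable over ℤ × (0,∞): the phonon has a
finite L² lifetime τ₂(T) in the
dynamic disorder ω₂ + 3·lam·q_x(t)², 1 + 3β·r_b(t)² that the chain generates itself; AND Green–Kubo
holds for (D, μ_T)
(HasGreenKubo: C_T ∈ L¹(0,∞), κ_GK(T) > 0). X = SD1-witness ∧ GreenKubo is reached from three
cruxes: SD1 (existence of a dephased
Gibbs dynamics), SD2 LifetimeControlsCurrent (finite one-phonon L² lifetime ⇒ C_T ∈ L¹: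
dephasing-limited transport, the card's
MediumTransfer in intrinsic form) and SD3 NoSelfLocalization (C_T ∈ L¹ ⇒ κ_GK > 0: dynamic
self-disorder does not localise).
X implies FourierGreenKubo's crux 0703 (greenKubo_of_target, Sketch.lean) and, with the shared frame
NessUnique (0741),
FiniteResponseOfUnique (0717), ThermodynamicLimit (0742) and the PROVED fact
CuneoEckmannHairerReyBellet2018_pinnedChain, FouriersLaw.
Lean: `∀ ω₂ lam β γ : ℝ, 0 < ω₂ → 0 < lam → 0 < β → 0 < γ → ∀ T : ℝ, 0 < T → ∃ μ :
MeasureTheory.Measure Literature.MathematicalPhysics.KineticTheory.HeatConduction.ChainConfig,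
(Literature.MathematicalPhysics.KineticTheory.HeatConduction.pinnedChain ω₂ lam β
γ).IsChainGibbsMeasure T μ ∧ ∃ D :
Literature.MathematicalPhysics.KineticTheory.HeatConduction.InfiniteChainDynamics
(Literature.MathematicalPhysics.KineticTheory.HeatConduction.pinnedChain ω₂ lam β γ),
D.PreservesMeasure μ ∧ ((∀ t : ℝ, D.HasAbsConvergentCorrelation μ t) ∧ (∀ (t : ℝ) (x : ℤ),
MeasureTheory.Integrable (fun σ => (σ 0).1 * (D.flow t σ x).1) μ ∧ MeasureTheory.Integrable (fun σ
=> (σ 0).1 * (D.flow t σ x).2) μ ∧ MeasureTheory.Integrable (fun σ => (σ 0).2 * (D.flow t σ x).1) μ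
∧ MeasureTheory.Integrable (fun σ => (σ 0).2 * (D.flow t σ x).2) μ) ∧ (∀ x : ℤ,
MeasureTheory.IntegrableOn (fun t : ℝ => (MeasureTheory.integral μ (fun σ => (σ 0).1 * (D.flow t σ
x).1)) ^ 2 + (MeasureTheory.integral μ (fun σ => (σ 0).1 * (D.flow t σ x).2)) ^ 2 +
(MeasureTheory.integral μ (fun σ => (σ 0).2 * (D.flow t σ x).1)) ^ 2 + (MeasureTheory.integral μ
(fun σ => (σ 0).2 * (D.flow t σ x).2)) ^ 2) (Set.Ioi 0) MeasureTheory.volume) ∧ Summable (fun x : ℤ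
=> MeasureTheory.integral (MeasureTheory.volume.restrict (Set.Ioi (0:ℝ))) (fun t : ℝ =>
(MeasureTheory.integral μ (fun σ => (σ 0).1 * (D.flow t σ x).1)) ^ 2 + (MeasureTheory.integral μ
(fun σ => (σ 0).1 * (D.flow t σ x).2)) ^ 2 + (MeasureTheory.integral μ (fun σ => (σ 0).2 * (D.flow t
σ x).1)) ^ 2 + (MeasureTheory.integral μ (fun σ => (σ 0).2 * (D.flow t σ x).2)) ^ 2))) ∧
D.HasGreenKubo μ T`

## Assembly
Pure logic, PROVED in the planner folder (Sketch.lean, theorem assembly_proof, lean check rc 0,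
axioms propext / Classical.choice /
Quot.sound): OnePhononL2Decay supplies (μ_T, D) with absolutely convergent correlations and finite
lifetime; LifetimeControlsCurrent gives
C_T ∈ L¹; NoSelfLocalization gives κ_GK > 0, hence HasGreenKubo — FourierGreenKubo's crux 0703 with
a dephased witness (Target);
clause (i) of FouriersLawFor from the PROVED fact CuneoEckmannHairerReyBellet2018_pinnedChain (N ≥
1) / OscillatorChain.isSteadyState_zero
(N = 0) plus NessUnique; clause (ii) with κ T := greenKuboConductivity of the ThermodynamicLimit
witness (Classical.choose; 1 for T ≤ 0),
positivity by HasGreenKubo.pos, D_N from FiniteResponseOfUnique and D_N → κ T from the witness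
clause of ThermodynamicLimit. Provers:
import Literature.MathematicalPhysics.KineticTheory.InfiniteChainDynamics and …LangevinChainNESS (or
the route file).

Rationale: WHY THIS LINE. Mechanism (card tangent-flow-self-dephasing): a heat-carrying lattice wave sees the
anharmonic chain as a harmonic crystal with positive
time-dependent stiffnesses — dynamic disorder generated by the chain itself — and in an EXOGENOUS
Markov medium such a wave dephases
while its intensity DIFFUSES with D ∝ (disorder coupling)⁻² for every non-zero coupling
(KangSchenker2009 Thm 1, Pillet1985; white-noise
limit D = 2J²/Γ, HakenStrobl1973; dynamic disorder even destroys Anderson localisation,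
FrohlichSchenker2016; dephasing noise makes
harmonic lattices exactly Fourier, Znidaric2010, AsadianEtAl2013), and D ∝ λ⁻² with Γ ∝ (lam·T)² is
the kinetic law κ ∝ (lam·T)⁻² of
AokiLukkarinenSpohn2006 read as motional narrowing. Imported area: waves in time-dependent random
media, with the explicit dictionary
mean field ⟨G⟩ ↦ one-phonon block G_ab (SD1), "no transport channel outlives the dephasing time" ↦
SD2, "dynamic disorder never
localises" ↦ SD3, D ∝ λ⁻² ↦ the quantitative kill criterion κ(T) ≍ ⟨V″(r)⟩_T·τ₂(T). What is
deliberately NOT claimed (planner's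
assessment, NOTES.md): a literal transfer of Kang–Schenker — the symplectic tangent flow of a
chaotic chain amplifies tangent INTENSITY
at the Lyapunov rate (only first moments dephase) and the self-generated medium has no spectral gap
(the conserved energy gives q_x² a
t^(−1/2) tail), so the card's surrogate-medium sandwich is replaced by intrinsic statements about
equilibrium correlations of the true
chain, where the Gaussian (Isserlis1918) part of the current 4-point function is controlled by the
one-phonon block and only the
connected cumulants remain. Versus the open routes: FourierGreenKubo keeps GreenKubo (0703)
monolithic — this route DECOMPOSES it into
a 2-point decay, a 2-point ⇒ 4-point domination and a positivity statement with three different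
failure modes; TwoChannelDephasing
splits the BOUNDARY conductance of finite chains into coherent/incoherent channels and leaves the
incoherent engine open — here the
objects are bulk and infinite-volume, the N → ∞ step is the shared ThermodynamicLimit, and SD2 is an
explicit engine claim for the
incoherent channel; DrudeMourre obtains positivity of the current spectral density for T ≤ T₀ by
Mourre theory — SD3 is the
all-temperature, engine-free counterpart it could feed.

RANKED CRUXES. #0 Target (target) — for all ω₂, lam, β, γ > 0 and T > 0 there are a DLR Gibbs state
μ and a μ-preserving infinite-volume dynamics D with absolutely convergent current correlations at
every time, finite one-phonon L² lifetime (integrable integrands; for each x, t ↦ Σ_{a,b∈{q,p}} (∫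
a_0·(b_x∘φ_t) dμ)² integrable on (0,∞); the integrals summable over x ∈ ℤ) AND HasGreenKubo (C_T ∈
L¹, κ_GK > 0). Forgetting the lifetime gives FourierGreenKubo.FourierGreenKubo
(stmt-AtomisticToContinuum-0703) — greenKubo_of_target in Sketch.lean. (why it might fail: Inherits
SD1–SD3: no decay of any equilibrium time-correlation is proved for a deterministic anharmonic
lattice, and C_T ∉ L¹ (κ = ∞) at strong pinning anharmonicity (breather tails) is conceivable even
with dephased phonons.) [BonettoLebowitzReyBellet2000, AokiLukkarinenSpohn2006, KangSchenker2009]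
#2 LifetimeControlsCurrent (crux) — SD2, DEPHASING-LIMITED TRANSPORT (card item MediumTransfer,
intrinsic form): for pinnedChain (all parameters > 0), T > 0, every DLR Gibbs state μ and
μ-preserving dynamics D with absolutely convergent current correlations: if the one-phonon block (∫
a_0·(b_x∘φ_t) dμ, a,b ∈ {q,p}) is square-integrable over ℤ × (0,∞) (integrands integrable,
t-integrability for each x, summability in x), then t ↦ C_T(t) = currentCorrelation D μ t = Σ_x ∫
j_0·(j_x∘φ_t) dμ is integrable on (0,∞). Content: j_x = −½(p_x + p_(x+1))(r_x + βr_x³); the Gaussian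
(Isserlis) part of ⟨j_0 j_x(t)⟩ is a sum of products of ≥ 2 one-phonon functions, in L¹ by
Cauchy–Schwarz from the hypothesis; the claim is that the connected 4-, 6-, 8-point cumulants of (p,
r) decay no slower — "no transport channel outlives the phonon", the Haken–Strobl / Kang–Schenker
step D ≍ v²τ. [difficulty: open-problem] (why it might fail: 2-point L² decay does not bound the
connected 4/6/8-point cumulants of (p,r): a quasi-conserved charge orthogonal to the flip-odd
one-phonon sector (Mazur1969) or breather-trapped energy at strong pinning anharmonicity
(DeRoeckHuveneers2015 regime) leaves C_T ∉ L¹ with τ₂ < ∞.) [KangSchenker2009, HakenStrobl1973,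
AokiLukkarinenSpohn2006, Isserlis1918, Mazur1969, DeRoeckHuveneers2015,
BonettoLebowitzReyBellet2000, Lukkarinen2016]
#3 OnePhononL2Decay (crux) — SD1, THE DEPHASING INPUT (card item SingleSiteDecorrelation, moved from
the site energy — which carries the conserved-energy t^(−1/2) tail — to the flip-odd one-phonon
sector): for all parameters > 0 and T > 0 there exist a DLR Gibbs state μ and a μ-preserving
infinite-volume dynamics D (cf. InfiniteVolumeSetup, 0743) with absolutely convergent current
correlations at every time such that, for a,b ∈ {q,p}, the integrands a_0·(b_x∘φ_t) are
μ-integrable, t ↦ Σ_{a,b} (∫ a_0·(b_x∘φ_t) dμ)² is integrable on (0,∞) for each x ∈ ℤ, and these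
integrals are summable over x: finite L² phonon lifetime τ₂(T). By Gaussian integration by parts in
p_0 these functions are T × the Gibbs-averaged tangent-flow elements ∂(q_x,p_x)(t)/∂p_0 (and
time-antiderivatives): the AVERAGED linearised dynamics dephases although ‖U_t‖ grows at the
Lyapunov rate. Structural reason it is easier than transport: (q,p) ↦ (−q,−p) is a symmetry of
pinnedChain and its Gibbs state, q and p are odd, every functional of the energy field is even, so
the block has no hydrodynamic projection at any order. [difficulty: open-problem] (why it might
fail: False at lam=β=0 (Σ_x G² does not decay in t: HarmonicChainBallisticFlux corner) and
non-uniform as lam·T→0 (τ₂~(lamT)⁻²); decay of equilibrium correlations of the infinite anharmonic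
chain is open (even ergodicity); KAM-like islands or breathers of positive Gibbs weight would leave
a tail.) [LukkarinenSpohn2010, AokiLukkarinenSpohn2006, Lukkarinen2016, LanfordLebowitzLieb1977,
ButtaEtAl2007, LefevereSchenkel2006, HuveneersLukkarinen2020]
#4 NoSelfLocalization (crux) — SD3, DYNAMIC SELF-DISORDER DOES NOT LOCALISE: for all parameters > 0,
T > 0, every DLR Gibbs state μ and μ-preserving dynamics D with absolutely convergent current
correlations: C_T ∈ L¹(0,∞) ⇒ κ_GK = greenKuboConductivity D μ T = T⁻²∫_0^∞ C_T > 0. Since C_T is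
even and positive-definite (stationarity, translation invariance, momentum reversal), ∫_0^∞ C_T =
½Ĉ_T(0) ≥ 0 automatically (Bochner); the content is STRICT positivity — the energy current of the
pinned chain is not asymptotically a time-derivative, i.e. no insulating phase: the intrinsic form
of "Markov dynamic disorder delocalises" (FrohlichSchenker2016), needed at every T, not only in the
kinetic corner (DrudeMourre) . [difficulty: open-problem] (why it might fail: Asymptotic
localisation (DeRoeckHuveneers2015: κ below every power of the coupling in the strongly anharmonic
atomic limit) puts positivity beyond all orders there; delocalisation by dynamic disorder is a
theorem only for EXOGENOUS Markov media with a spectral gap.) [FrohlichSchenker2016,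
KangSchenker2009, DeRoeckHuveneers2015, BernardinHuveneers2013, Dhar2008,
BonettoLebowitzReyBellet2000]
#5 ThermodynamicLimit (crux) — identical signature to FourierGreenKubo.ThermodynamicLimit
(stmt-AtomisticToContinuum-0742; dedup intended): under weak-NESS uniqueness and T > 0, if some
Gibbs state with a μ_T-preserving Green–Kubo dynamics exists, such a witness (μ_T, D) can be fixed
before the steady-state family so that for every steady-state family and every sequence of finite-N
response coefficients D_N one has D_N → greenKuboConductivity D μ_T T. This route claims NO new
engine for it: the card's "N-uniformity inherited from the N-independence of the local dephasing
rate" is exactly this step, the shared residual of every bulk (infinite-volume) line. [difficulty: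
open-problem] (why it might fail: Needs N-uniform decay of equilibrium current correlations of the
thermostatted chain + o(1) boundary layers; the open-chain spectral gap closes like γ/N
(BeckerMenegaki2022) and κ = κ_GK is unproved even formally (BonettoLebowitzReyBellet2000 §7).)
[BonettoLebowitzReyBellet2000, Dhar2008, KunduDharNarayan2009, ReyBellet2003,
Literature.Barriers.AtomisticToContinuum.HasBoundedResponse,
Literature.Barriers.AtomisticToContinuum.BeckerMenegaki2022_gapClosing]
#9 NessUnique (support) — identical signature to FourierGreenKubo.NessUnique
(stmt-AtomisticToContinuum-0741; dedup intended): uniqueness of the weak steady state (IsSteadyState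
class) of pinnedChain for all N, T_L, T_R > 0; with the proved existence fact it is clause (i) of
FouriersLawFor and the hypothesis of FiniteResponseOfUnique / ThermodynamicLimit. [difficulty: M]
[CuneoEckmannHairerReyBellet2018, Carmona2007]
#9 FiniteResponseOfUnique (support) — identical signature to
FourierGreenKubo.FourierFiniteResponseOfUnique (stmt-AtomisticToContinuum-0717; dedup intended):
under weak-NESS uniqueness the finite-N linear-response limit D_N(T) = lim_{δ→0,δ≠0} totalCurrent(μ
N (T+δ/2) (T−δ/2))/δ exists for every steady-state family, T > 0 and N (Hairer–Majda / finite-volume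
Kubo formula). [difficulty: L] [ReyBellet2003, HairerMajda2009]
#9 InfiniteVolumeSetup (support) — identical signature to FourierGreenKubo.InfiniteVolumeSetup
(stmt-AtomisticToContinuum-0743; dedup intended): for all parameters > 0 and T > 0 a DLR Gibbs state
of the pinned chain and a μ_T-preserving infinite-volume dynamics exist (transfer operator /
superstability; LanfordLebowitzLieb1977 Thm 3–4, ButtaEtAl2007-type locality) — the carrier on which
OnePhononL2Decay is stated. [difficulty: L] [LanfordLebowitzLieb1977, ButtaEtAl2007]

TWO-LAYER PLAN. Foreseen glued splits (none filed now; k ≤ 3, depth 1): OnePhononL2Decay ⇐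
KineticCornerDecay (τ₂ < ∞ for T ≤ T₀ from the one-phonon
golden rule / kinetic damping of LukkarinenSpohn2010 type; shares technology with DrudeMourre and
card phonon-lifetime-one-particle-sector)
→ DecayContinuation (propagation in T along the scaling ray (lamT, βT)) → OnePhononL2Decay.
LifetimeControlsCurrent ⇐ GaussianPart
(the Isserlis terms of ⟨j_0 j_x(t)⟩ are in L¹ from the hypothesis by Cauchy–Schwarz: provable-now
glue) → CumulantDomination (connected
4/6/8-point parts ∈ L¹) → LifetimeControlsCurrent. NoSelfLocalization ⇐ SpectralDensityForm (κ_GK =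
½T⁻²Ĉ_T(0) via Bochner) →
NonCoboundary (Ĉ_T(0) > 0: the current is not an H₋₁-coboundary) → NoSelfLocalization.

KILL CRITERIA. (a) ¬OnePhononL2Decay at some admissible (lam, β, T) — a coherent one-phonon mode
surviving in the anharmonic chain — closes the route
(`refuted:OnePhononL2Decay`) and wounds TwoChannelDephasing's CoherentDephasing equally. (b)
¬LifetimeControlsCurrent (C_T ∉ L¹ although
τ₂ < ∞: an incoherent channel slower than the phonon, e.g. breather-trapped energy) kills the
dephasing-limited THESIS; together with
ThermodynamicLimit it would give κ = ∞, i.e. ¬FouriersLaw — file it. (c) ¬NoSelfLocalization = an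
insulating pinned anharmonic chain ⇒
¬FouriersLaw likewise. (d) Quantitative signature (numerics, recorded here, not an item): the
Haken–Strobl law κ(T) ≍ ⟨V″(r_0)⟩_T · τ₂(T)
with T-INDEPENDENT constants is scaling-consistent in both corners ((lamT)⁻² on both sides as T → 0;
T^(1/4) = T^(1/2)·T^(−1/4) in the
quartic corner T → ∞); equilibrium-MD values of τ₂ against NEMD/literature κ at T ∈ {0.2, 1, 5, 25}
drifting like a power of T retire
the "one engine across regimes" claim and demote SD2 to a kinetic-corner statement. (e) GreenKubo
(0703) proved monolithically elsewhere
moots SD2–SD3 but leaves SD1 as this route's theorem; ThermodynamicLimit refuted kills every bulk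
line at once (pivot to boundary
objects = TwoChannelDephasing).

NOT DECOMPOSED YET. The engine for SD1 (one-phonon FGR/Mourre at small lam·T versus inhomogeneous
dephasing at large; any rate or exponential-in-x form —
only L² is filed); the cumulant bookkeeping of SD2 (which connected functions of (p, r), which mixed
norms); the Bochner/spectral
reformulation of SD3; T-continuity of κ; the EXOGENOUS rung (Kang–Schenker diffusion ⇒ BLR
conductivity for a number-conserving
Markov-modulated harmonic/RWA chain between two reservoirs — a theorem target of independent
interest that needs a new model structure;
deliberately not requested: it calibrates the dictionary but is not load-bearing for pinnedChain);
everything at finite N (owned by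
TwoChannelDephasing / FeketeResistance / SuperadditiveJunction).

CHEAPEST FALSIFIER. Equilibrium MD of the closed pinned chain (periodic, N = 512, (ω₂, lam, β) = (1,
1, 1), T = 1 then T = 5): accumulate
S(t_max) = Σ_x ∫_0^{t_max} Σ_{ab} G_ab(x,t)² dt and I(t_max) = ∫_0^{t_max} C_T; SD1 says S
saturates, SD2 says I saturates on the SAME
time scale ~τ₂; an incoherent tail saturating much later (ratio of saturation times growing with T)
falsifies the dephasing-limited
picture at once, and a non-saturating S falsifies SD1. Not run in this unit (no kit budget here).
Analytic checks done: harmonic corner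
(τ₂ = ∞, SD1 false as it must be), kinetic corner (both sides ∝ (lamT)⁻²), quartic corner (exponents
match), flip-parity (no
hydrodynamic projection of the one-phonon block).

NUMBERS. Kinetic corner: κ(T)(lam·T)² → κ_kin for the pinned quartic chain (AokiLukkarinenSpohn2006
§3 (3.25)–(3.28)); Kang–Schenker:
D(λ) = λ⁻²(D⁰ + O(λ)) positive definite (KangSchenker2009 Thm 1, arXiv:0808.2784 p. 6);
Haken–Strobl: D = 2J²/Γ (HakenStrobl1973).
High-T (pure quartic) scaling of pinnedChain: κ ∝ T^(1/4), τ₂ ∝ T^(−1/4), ⟨V″(r)⟩_T ∝ T^(1/2)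
(dimensional analysis of H ↦ s⁴H,
NOTES.md). Items at open: 9 (own cruxes 3 + shared crux 0742, shared supports 0741/0717/0743,
target, assembly).

DEFINITION REQUESTS. None. ChainConfig, InfiniteChainDynamics (flow, PreservesMeasure,
HasAbsConvergentCorrelation, currentCorrelation, greenKuboConductivity,
HasGreenKubo), IsChainGibbsMeasure live in
Literature.MathematicalPhysics.KineticTheory.InfiniteChainDynamics; the finite-N frame
(pinnedChain, IsSteadyState, totalCurrent, FouriersLaw, CuneoEckmannHairerReyBellet2018_pinnedChain)
in …FouriersLaw / …LangevinChainNESS;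
the one-phonon block is written inline (no helper definition).

Novelty: Searches (2026-08-15): `lit frontier AtomisticToContinuum --since 2020` (30 rows; no dephasing /
dynamic-disorder work);
`lit bridges AtomisticToContinuum --cross any` (30 rows; none relevant); `lit search --source
crossref "Diffusion of wave packets in a
Markov random potential"` (8; KangSchenker2009), `… "Lefevere Schenkel normal heat conductivity
strongly pinned chain"` (6;
LefevereSchenkel2006, doi:10.1103/physrevlett.96.100601), `… "heat conduction harmonic chain
time-dependent random frequencies
stochastic modulation"` (15; 0 relevant); `lit vsearch "conductivity of an anharmonic chain through
the phonon lifetime; dephasing by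
thermal fluctuations"` (12 book hits, all the textbook Peierls relaxation-time picture:
book:kaviany2014-heat-transfer-physics p. 217,
book:dove1993-introduction-lattice-dynamics p. 114); `lit galaxy search "phonon lifetime" --star
all` (32 rows, materials science only);
`lit read arXiv:0808.2784` (Thm 1, p. 6); the local FTS index and openalex / s2 / arxiv were
unreachable during the session (connection
resets / HTTP 429 — recorded, not worked around); plus the card's 13 searched references and its
refuter audit (Znidaric2010,
AsadianEtAl2013, Ruelle2009, HairerMajda2009), and the 12 open FouriersLaw route files read for
overlap.
Nearest prior art found: KangSchenker2009 / Pillet1985 / FrohlichSchenker2016 (diffusion and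
delocalisation for a wave in an EXOGENOUS
Markov medium); HakenStrobl1973, Znidaric2010, AsadianEtAl2013 (imposed dephasing ⇒ e  [refs: 10.1103/physrevlett.96.100601, 0808.2784, doi:10.1103/physrevlett.96.100601, book:kaviany2014-heat-transfer-physics, book:dove1993-introduction-lattice-dynamics, KangSchenker2009, LefevereSchenkel2006, Znidaric2010, AsadianEtAl2013, Ruelle2009, HairerMajda2009, Pillet1985, FrohlichSchenker2016, HakenStrobl1973, AokiLukkarinenSpohn2006, Lukkarinen2016]

Barriers (technique_class: self-dephasing one-phonon-lifetime cumulant-domination): - technique_class: self-dephasing one-phonon-lifetime cumulant-domination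
- Literature.Barriers.AtomisticToContinuum.HarmonicChainBallisticFlux: the lam = β = 0 corner is
exactly where SD1 is false (Σ_x G² does not decay in t); all statements are for lam, β > 0 at fixed
T and claim nothing uniformly in the anharmonicity.
- Literature.Barriers.AtomisticToContinuum.LowTemperatureWeakAnharmonicity: no T-uniformity is
claimed; τ₂ ~ κ ~ (lamT)⁻² is the predicted common divergence
(AokiLukkarinenSpohn2006_kineticLowTemperature_prediction), used as a consistency check, not
contradicted.
- Literature.Barriers.AtomisticToContinuum.Mazur1969_inequality: a conserved or quasi-conserved
charge overlapping J is precisely the recorded failure mode of LifetimeControlsCurrent (it lives in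
the connected 4-point part, invisible to the flip-odd one-phonon block); not evaded — kill criterion
(b).
- Literature.Barriers.AtomisticToContinuum.DeRoeckHuveneers2015_thm2: positivity (SD3) and cumulant
control (SD2) cannot come from an expansion in the coupling; they are filed non-perturbatively at
fixed parameters, conceding that the strongly-anharmonic-pinning corner is where both are hardest.
- Literature.Barriers.AtomisticToContinuum.HasBoundedResponse: every own crux is an infinite-volume
equilibrium statement; N-dependence is confined to the shared ThermodynamicLimit (0742), marked as
not attacked here — it does not evade the barrier; the bet is that bulk decay is the transferable
half.
- Literatur

History (route lifecycle, newest last):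
- 2026-08-15T13:46:36Z · CLOSED retired — not-a-thesis: assembly does not conclude the sub-problem Statement (operator:999:1257524)

sub-problem: FouriersLaw · status: closed(retired) · opened planner-plancard-AtomisticToContinuum-Fourier-a1ac1a18-0 2026-08-15T11:28:11Z · rev 0 · ledger route-AtomisticToContinuum-SelfDephasing
GENERATED by the gate from the ledger (D-0016/17). Provers cite these decls: `theorem foo : Summit.AtomisticToContinuum.FouriersLaw.Theses.SelfDephasing.<Decl> := …` in Summits/AtomisticToContinuum/FouriersLaw/Theorems/<Name>.lean.
-/

namespace Summit.AtomisticToContinuum.FouriersLaw.Theses.SelfDephasing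

open scoped BigOperators Topology Manifold Classical MeasureTheory ProbabilityTheory Matrix InnerProductSpace ComplexConjugate ContinuousMap
open Filter Set Function TopologicalSpace MeasureTheory

attribute [summit_statement] _root_.FouriersLaw

/-- item stmt-AtomisticToContinuum-4122 · target · rank 0 · closed · moot by None · by planner
why it might fail: Inherits SD1–SD3: no decay of any equilibrium time-correlation is proved for a deterministic anharmonic lattice, and C_T ∉ L¹ (κ = ∞) at strong pinning anharmonicity (breather tails) is conceivable even with dephased phonons.
sources: BonettoLebowitzReyBellet2000, AokiLukkarinenSpohn2006, KangSchenker2009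
[target] for all ω₂, lam, β, γ > 0 and T > 0 there are a DLR Gibbs state μ and a μ-preserving
infinite-volume dynamics D with absolutely convergent current correlations at every time, finite
one-phonon L² lifetime (integrable integrands; for each x, t ↦ Σ_{a,b∈{q,p}} (∫ a_0·(b_x∘φ_t) dμ)²
integrable on (0,∞); the integrals summable over x ∈ ℤ) AND HasGreenKubo (C_T ∈ L¹, κ_GK > 0).
Forgetting the lifetime gives FourierGreenKubo.FourierGreenKubo (stmt-AtomisticToContinuum-0703) —
greenKubo_of_target in Sketch.lean. -/
@[route_item "route-AtomisticToContinuum-SelfDephasing"]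
def Target : Prop :=
  ∀ ω₂ lam β γ : ℝ, 0 < ω₂ → 0 < lam → 0 < β → 0 < γ → ∀ T : ℝ, 0 < T → ∃ μ : MeasureTheory.Measure Literature.MathematicalPhysics.KineticTheory.HeatConduction.ChainConfig, (Literature.MathematicalPhysics.KineticTheory.HeatConduction.pinnedChain ω₂ lam β γ).IsChainGibbsMeasure T μ ∧ ∃ D : Literature.MathematicalPhysics.KineticTheory.HeatConduction.InfiniteChainDynamics (Literature.MathematicalPhysics.KineticTheory.HeatConduction.pinnedChain ω₂ lam β γ), D.PreservesMeasure μ ∧ ((∀ t : ℝ, D.HasAbsConvergentCorrelation μ t) ∧ (∀ (t : ℝ) (x : ℤ), MeasureTheory.Integrable (fun σ => (σ 0).1 * (D.flow t σ x).1) μ ∧ MeasureTheory.Integrable (fun σ => (σ 0).1 * (D.flow t σ x).2) μ ∧ MeasureTheory.Integrable (fun σ => (σ 0).2 * (D.flow t σ x).1) μ ∧ MeasureTheory.Integrable (fun σ => (σ 0).2 * (D.flow t σ x).2) μ) ∧ (∀ x : ℤ, MeasureTheory.IntegrableOn (fun t : ℝ => (MeasureTheory.integral μ (fun σ => (σ 0).1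 * (D.flow t σ x).1)) ^ 2 + (MeasureTheory.integral μ (fun σ => (σ 0).1 * (D.flow t σ x).2)) ^ 2 + (MeasureTheory.integral μ (fun σ => (σ 0).2 * (D.flow t σ x).1)) ^ 2 + (MeasureTheory.integral μ (fun σ => (σ 0).2 * (D.flow t σ x).2)) ^ 2) (Set.Ioi 0) MeasureTheory.volume) ∧ Summable (fun x : ℤ => MeasureTheory.integral (MeasureTheory.volume.restrict (Set.Ioi (0:ℝ))) (fun t : ℝ => (MeasureTheory.integral μ (fun σ => (σ 0).1 * (D.flow t σ x).1)) ^ 2 + (MeasureTheory.integral μ (fun σ => (σ 0).1 * (D.flow t σ x).2)) ^ 2 + (MeasureTheory.integral μ (fun σ => (σ 0).2 * (D.flow t σ x).1)) ^ 2 + (MeasureTheory.integral μ (fun σ => (σ 0).2 * (D.flow t σ x).2)) ^ 2))) ∧ D.HasGreenKubo μ T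

/-- item stmt-AtomisticToContinuum-4123 · crux · rank 2 · closed · moot by None · by planner
why it might fail: 2-point L² decay does not bound the connected 4/6/8-point cumulants of (p,r): a quasi-conserved charge orthogonal to the flip-odd one-phonon sector (Mazur1969) or breather-trapped energy at strong pinning anharmonicity (DeRoeckHuveneers2015 regime) leaves C_T ∉ L¹ with τ₂ < ∞.
sources: KangSchenker2009, HakenStrobl1973, AokiLukkarinenSpohn2006, Isserlis1918, Mazur1969, DeRoeckHuveneers2015
[crux] SD2, DEPHASING-LIMITED TRANSPORT (card item MediumTransfer, intrinsic form): for pinnedChain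
(all parameters > 0), T > 0, every DLR Gibbs state μ and μ-preserving dynamics D with absolutely
convergent current correlations: if the one-phonon block (∫ a_0·(b_x∘φ_t) dμ, a,b ∈ {q,p}) is
square-integrable over ℤ × (0,∞) (integrands integrable, t-integrability for each x, summability in
x), then t ↦ C_T(t) = currentCorrelation D μ t = Σ_x ∫ j_0·(j_x∘φ_t) dμ is integrable on (0,∞).
Content: j_x = −½(p_x + p_(x+1))(r_x + βr_x³); the Gaussian (Isserlis) part of ⟨j_0 j_x(t)⟩ is a sum
of products of ≥ 2 one-phonon functions, in L¹ by Cauchy–Schwarz from the hypothesis; the claim is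
that the connected 4-, 6-, 8-point cumulants of (p, r) decay no slower — "no transport channel
outlives the phonon", the Haken–Strobl / Kang–Schenker step D ≍ v²τ. [difficulty: open-problem] -/
@[route_item "route-AtomisticToContinuum-SelfDephasing"]
def LifetimeControlsCurrent : Prop :=
  ∀ ω₂ lam β γ : ℝ, 0 < ω₂ → 0 < lam → 0 < β → 0 < γ → ∀ T : ℝ, 0 < T → ∀ (μ : MeasureTheory.Measure Literature.MathematicalPhysics.KineticTheory.HeatConduction.ChainConfig) (D : Literature.MathematicalPhysics.KineticTheory.HeatConduction.InfiniteChainDynamics (Literature.MathematicalPhysics.KineticTheory.HeatConduction.pinnedChain ω₂ lam β γ)), (Literature.MathematicalPhysics.KineticTheory.HeatConduction.pinnedChain ω₂ lam β γ).IsChainGibbsMeasure T μ → D.PreservesMeasure μ → (∀ t : ℝ, D.HasAbsConvergentCorrelation μ t) → (∀ (t : ℝ) (x : ℤ), MeasureTheory.Integrable (fun σ => (σ 0).1 * (D.flow t σ x).1) μ ∧ MeasureTheory.Integrable (fun σ => (σ 0).1 * (D.flow t σ x).2) μ ∧ MeasureTheory.Integrable (fun σ => (σ 0).2 * (D.flow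 t σ x).1) μ ∧ MeasureTheory.Integrable (fun σ => (σ 0).2 * (D.flow t σ x).2) μ) ∧ (∀ x : ℤ, MeasureTheory.IntegrableOn (fun t : ℝ => (MeasureTheory.integral μ (fun σ => (σ 0).1 * (D.flow t σ x).1)) ^ 2 + (MeasureTheory.integral μ (fun σ => (σ 0).1 * (D.flow t σ x).2)) ^ 2 + (MeasureTheory.integral μ (fun σ => (σ 0).2 * (D.flow t σ x).1)) ^ 2 + (MeasureTheory.integral μ (fun σ => (σ 0).2 * (D.flow t σ x).2)) ^ 2) (Set.Ioi 0) MeasureTheory.volume) ∧ Summable (fun x : ℤ => MeasureTheory.integral (MeasureTheory.volume.restrict (Set.Ioi (0:ℝ))) (fun t : ℝ => (MeasureTheory.integral μ (fun σ => (σ 0).1 * (D.flow t σ x).1)) ^ 2 + (MeasureTheory.integral μ (fun σ => (σ 0).1 * (D.flow t σ x).2)) ^ 2 + (MeasureTheory.integral μ (fun σ => (σ 0).2 * (D.flow t σ x).1)) ^ 2 + (MeasureTheory.integral μ (fun σ => (σ 0).2 * (D.flow t σ x).2)) ^ 2)) → MeasureTheory.IntegrableOn (D.currentCorrelation μ) (Set.Ioi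 0) MeasureTheory.volume

/-- item stmt-AtomisticToContinuum-4124 · crux · rank 3 · closed · moot by None · by planner
why it might fail: False at lam=β=0 (Σ_x G² does not decay in t: HarmonicChainBallisticFlux corner) and non-uniform as lam·T→0 (τ₂~(lamT)⁻²); decay of equilibrium correlations of the infinite anharmonic chain is open (even ergodicity); KAM-like islands or breathers of positive Gibbs weight would leave a tail.
sources: LukkarinenSpohn2010, AokiLukkarinenSpohn2006, Lukkarinen2016, LanfordLebowitzLieb1977, ButtaEtAl2007, LefevereSchenkel2006
[crux] SD1, THE DEPHASING INPUT (card item SingleSiteDecorrelation, moved from the site energy —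
which carries the conserved-energy t^(−1/2) tail — to the flip-odd one-phonon sector): for all
parameters > 0 and T > 0 there exist a DLR Gibbs state μ and a μ-preserving infinite-volume dynamics
D (cf. InfiniteVolumeSetup, 0743) with absolutely convergent current correlations at every time such
that, for a,b ∈ {q,p}, the integrands a_0·(b_x∘φ_t) are μ-integrable, t ↦ Σ_{a,b} (∫ a_0·(b_x∘φ_t)
dμ)² is integrable on (0,∞) for each x ∈ ℤ, and these integrals are summable over x: finite L²
phonon lifetime τ₂(T). By Gaussian integration by parts in p_0 these functions are T × the
Gibbs-averaged tangent-flow elements ∂(q_x,p_x)(t)/∂p_0 (and time-antiderivatives): the AVERAGED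
linearised dynamics dephases although ‖U_t‖ grows at the Lyapunov rate. Structural reason it is
easier than transport: (q,p) ↦ (−q,−p) is a symmetry of pinnedChain and its Gibbs state, q and p are
odd, every functional of the energy field is even, so the block has no hydrodynamic projection at
any order. [difficulty: open-problem] -/
@[route_item "route-AtomisticToContinuum-SelfDephasing"]
def OnePhononL2Decay : Prop :=
  ∀ ω₂ lam β γ : ℝ, 0 < ω₂ → 0 < lam → 0 < β → 0 < γ → ∀ T : ℝ, 0 < T → ∃ μ : MeasureTheory.Measure Literature.MathematicalPhysics.KineticTheory.HeatConduction.ChainConfig, (Literature.MathematicalPhysics.KineticTheory.HeatConduction.pinnedChain ω₂ lam β γ).IsChainGibbsMeasure T μ ∧ ∃ D : Literature.MathematicalPhysics.KineticTheory.HeatConduction.InfiniteChainDynamics (Literature.MathematicalPhysics.KineticTheory.HeatConduction.pinnedChain ω₂ lam β γ), D.PreservesMeasure μ ∧ (∀ t : ℝ, D.HasAbsConvergentCorrelation μ t) ∧ (∀ (t : ℝ) (x : ℤ), MeasureTheory.Integrable (fun σ => (σ 0).1 * (D.flow t σ x).1) μ ∧ MeasureTheory.Integrable (fun σ => (σ 0).1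 * (D.flow t σ x).2) μ ∧ MeasureTheory.Integrable (fun σ => (σ 0).2 * (D.flow t σ x).1) μ ∧ MeasureTheory.Integrable (fun σ => (σ 0).2 * (D.flow t σ x).2) μ) ∧ (∀ x : ℤ, MeasureTheory.IntegrableOn (fun t : ℝ => (MeasureTheory.integral μ (fun σ => (σ 0).1 * (D.flow t σ x).1)) ^ 2 + (MeasureTheory.integral μ (fun σ => (σ 0).1 * (D.flow t σ x).2)) ^ 2 + (MeasureTheory.integral μ (fun σ => (σ 0).2 * (D.flow t σ x).1)) ^ 2 + (MeasureTheory.integral μ (fun σ => (σ 0).2 * (D.flow t σ x).2)) ^ 2) (Set.Ioi 0) MeasureTheory.volume) ∧ Summable (fun x : ℤ => MeasureTheory.integral (MeasureTheory.volume.restrict (Set.Ioi (0:ℝ))) (fun t : ℝ => (MeasureTheory.integral μ (fun σ => (σ 0).1 * (D.flow t σ x).1)) ^ 2 + (MeasureTheory.integral μ (fun σ => (σ 0).1 * (D.flow t σ x).2)) ^ 2 + (MeasureTheory.integral μ (fun σ => (σ 0).2 * (D.flow t σ x).1)) ^ 2 + (MeasureTheory.integral μ (fun σ => (σ 0).2 *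 (D.flow t σ x).2)) ^ 2))

/-- item stmt-AtomisticToContinuum-4125 · crux · rank 4 · closed · moot by None · by planner
why it might fail: Asymptotic localisation (DeRoeckHuveneers2015: κ below every power of the coupling in the strongly anharmonic atomic limit) puts positivity beyond all orders there; delocalisation by dynamic disorder is a theorem only for EXOGENOUS Markov media with a spectral gap.
sources: FrohlichSchenker2016, KangSchenker2009, DeRoeckHuveneers2015, BernardinHuveneers2013, Dhar2008, BonettoLebowitzReyBellet2000
[crux] SD3, DYNAMIC SELF-DISORDER DOES NOT LOCALISE: for all parameters > 0, T > 0, every DLR Gibbs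
state μ and μ-preserving dynamics D with absolutely convergent current correlations: C_T ∈ L¹(0,∞) ⇒
κ_GK = greenKuboConductivity D μ T = T⁻²∫_0^∞ C_T > 0. Since C_T is even and positive-definite
(stationarity, translation invariance, momentum reversal), ∫_0^∞ C_T = ½Ĉ_T(0) ≥ 0 automatically
(Bochner); the content is STRICT positivity — the energy current of the pinned chain is not
asymptotically a time-derivative, i.e. no insulating phase: the intrinsic form of "Markov dynamic
disorder delocalises" (FrohlichSchenker2016), needed at every T, not only in the kinetic corner
(DrudeMourre) . [difficulty: open-problem] -/
@[route_item "route-AtomisticToContinuum-SelfDephasing"]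
def NoSelfLocalization : Prop :=
  ∀ ω₂ lam β γ : ℝ, 0 < ω₂ → 0 < lam → 0 < β → 0 < γ → ∀ T : ℝ, 0 < T → ∀ (μ : MeasureTheory.Measure Literature.MathematicalPhysics.KineticTheory.HeatConduction.ChainConfig) (D : Literature.MathematicalPhysics.KineticTheory.HeatConduction.InfiniteChainDynamics (Literature.MathematicalPhysics.KineticTheory.HeatConduction.pinnedChain ω₂ lam β γ)), (Literature.MathematicalPhysics.KineticTheory.HeatConduction.pinnedChain ω₂ lam β γ).IsChainGibbsMeasure T μ → D.PreservesMeasure μ → (∀ t : ℝ, D.HasAbsConvergentCorrelation μ t) → MeasureTheory.IntegrableOn (D.currentCorrelation μ) (Set.Ioi 0) MeasureTheory.volume → 0 < D.greenKuboConductivity μ T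

/-- item stmt-AtomisticToContinuum-0742 · crux · rank 5 · open · by planner
why it might fail: Needs N-uniform decay of equilibrium current correlations of the thermostatted chain + o(1) boundary layers; the open-chain spectral gap closes like γ/N (BeckerMenegaki2022) and κ = κ_GK is unproved even formally (BonettoLebowitzReyBellet2000 §7).
sources: BonettoLebowitzReyBellet2000, Dhar2008, KunduDharNarayan2009, ReyBellet2003, Literature.Barriers.AtomisticToContinuum.HasBoundedResponse, Literature.Barriers.AtomisticToContinuum.BeckerMenegaki2022_gapClosing
[crux] THERMODYNAMIC LIMIT OF THE RESPONSE COEFFICIENT, WITNESS FORM (supersedes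
stmt-AtomisticToContinuum-0704; refuters g12-0/1/2/3/5: the ∀(μ_T,D) form hid the claim that κ_GK is
the same for every DLR state and every dynamics). Under weak-NESS uniqueness and T > 0, IF some
Gibbs state with a μ_T-preserving Green–Kubo dynamics exists (hypothesis = GreenKubo at T), THEN
there is such a pair (μ_T, D), fixed before the steady-state family is chosen, such that for every
steady-state family μ and every sequence Dn of finite-volume response coefficients (Dn N =
lim_{δ→0,δ≠0} totalCurrent(μ N (T+δ/2) (T−δ/2))/δ, existence = FiniteResponse, uniqueness of limits
makes Dn canonical) one has Dn → greenKuboConductivity D μ_T T. Content: finite-volume Kubo formula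
(ReyBellet2003 Rem 4.4 (56)) + N-uniform decay of equilibrium current correlations of the Langevin
chain + o(1) boundary layers at the baths; open (BonettoLebowitzReyBellet2000 §7 after (37)). N = 0,
1: Dn = 0, irrelevant to atTop. -/
@[route_item "route-AtomisticToContinuum-SelfDephasing"]
def ThermodynamicLimit : Prop :=
  ∀ ω₂ lam β γ : ℝ, 0 < ω₂ → 0 < lam → 0 < β → 0 < γ → (∀ (N : ℕ) (T_L T_R : ℝ), 0 < T_L → 0 < T_R → ∀ μ ν : MeasureTheory.Measure (Literature.MathematicalPhysics.KineticTheory.HeatConduction.PhaseSpace N), (Literature.MathematicalPhysics.KineticTheory.HeatConduction.pinnedChain ω₂ lam β γ).IsSteadyState N T_L T_R μ → (Literature.MathematicalPhysics.KineticTheory.HeatConduction.pinnedChain ω₂ lam β γ).IsSteadyState N T_L T_R ν → μ = ν) → ∀ T : ℝ, 0 < T → (∃ μT : MeasureTheory.Measure Literature.MathematicalPhysics.KineticTheory.HeatConduction.ChainConfig, (Literature.MathematicalPhysics.KineticTheory.HeatConduction.pinnedChain ω₂ lam β γ).IsChainGibbsMeasure T μT ∧ ∃ D : Literature.MathematicalPhysics.KineticTheory.HeatConduction.InfiniteChainDynamics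 (Literature.MathematicalPhysics.KineticTheory.HeatConduction.pinnedChain ω₂ lam β γ), D.PreservesMeasure μT ∧ D.HasGreenKubo μT T) → ∃ (μT : MeasureTheory.Measure Literature.MathematicalPhysics.KineticTheory.HeatConduction.ChainConfig) (D : Literature.MathematicalPhysics.KineticTheory.HeatConduction.InfiniteChainDynamics (Literature.MathematicalPhysics.KineticTheory.HeatConduction.pinnedChain ω₂ lam β γ)), (Literature.MathematicalPhysics.KineticTheory.HeatConduction.pinnedChain ω₂ lam β γ).IsChainGibbsMeasure T μT ∧ D.PreservesMeasure μT ∧ D.HasGreenKubo μT T ∧ ∀ μ : (N : ℕ) → ℝ → ℝ → MeasureTheory.Measure (Literature.MathematicalPhysics.KineticTheory.HeatConduction.PhaseSpace N), (∀ (N : ℕ) (T_L T_R : ℝ), 0 < T_L → 0 < T_R → (Literature.MathematicalPhysics.KineticTheory.HeatConduction.pinnedChain ω₂ lam β γ).IsSteadyState N T_L T_R (μ N T_L T_R)) → ∀ Dn : ℕ → ℝ, (∀ N : ℕ, Filter.Tendsto (fun δ : ℝ => (Literature.MathematicalPhysics.KineticTheory.HeatConduction.pinnedChain ω₂ lam β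 γ).totalCurrent (μ N (T + δ / 2) (T - δ / 2)) / δ) (nhdsWithin 0 {(0 : ℝ)}ᶜ) (nhds (Dn N))) → Filter.Tendsto Dn Filter.atTop (nhds (D.greenKuboConductivity μT T))

/-- item stmt-AtomisticToContinuum-0717 · support · rank 9 · closed · proved by Summit.AtomisticToContinuum.FouriersLaw.Theorems.FourierGreenKubo.finiteResponseOfUnique_holds (prover) · by planner
sources: ReyBellet2003, HairerMajda2009
CONDITIONAL FORM OF 0705 (supersedes it as the prover target; refuters pool-5/g3-0: 0705 stand-alone
quantifies over EVERY steady-state family and is false-prone if weak steady states were non-unique):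
assuming UNIQUENESS of weak steady states (IsSteadyState class) for pinnedChain at all N, T_L, T_R >
0, the finite-N linear-response limit D_N(T) = lim_{δ→0, δ≠0} totalCurrent(μ_{N,T+δ/2,T−δ/2})/δ
exists for every T > 0 and N. Content: differentiability at equilibrium of NESS expectations of the
polynomial currents in the bath temperatures (ReyBellet2003 arXiv:math-ph/0303021 Rem 4.4 (51)–(56)
finite-volume Green–Kubo; HairerMajda2009 arXiv:0909.4313 Thm 2.3 framework — their SDE Thm 4.4
Assumption 5 fails here, so verify Assumptions 1–3 via CEHR2018 (2.5)/Carmona2007 Thm 1.1(iv)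
weighted spectral gap). N = 0, 1: totalCurrent ≡ 0, D = 0. Together with 0706 gives 0705. -/
@[route_item "route-AtomisticToContinuum-SelfDephasing"]
def FiniteResponseOfUnique : Prop :=
  ∀ ω₂ lam β γ : ℝ, 0 < ω₂ → 0 < lam → 0 < β → 0 < γ → (∀ (N : ℕ) (T_L T_R : ℝ), 0 < T_L → 0 < T_R → ∀ μ ν : MeasureTheory.Measure (Literature.MathematicalPhysics.KineticTheory.HeatConduction.PhaseSpace N), (Literature.MathematicalPhysics.KineticTheory.HeatConduction.pinnedChain ω₂ lam β γ).IsSteadyState N T_L T_R μ → (Literature.MathematicalPhysics.KineticTheory.HeatConduction.pinnedChain ω₂ lam β γ).IsSteadyState N T_L T_R ν → μ = ν) → ∀ μ : (N : ℕ) → ℝ → ℝ → MeasureTheory.Measure (Literature.MathematicalPhysics.KineticTheory.HeatConduction.PhaseSpace N), (∀ (N : ℕ) (T_L T_R : ℝ), 0 < T_L → 0 < T_R → (Literature.MathematicalPhysics.KineticTheory.HeatConduction.pinnedChain ω₂ lam β γ).IsSteadyState N T_L T_R (μ N T_L T_R)) → ∀ T : ℝ, 0 < T → ∀ N : ℕ,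 ∃ D : ℝ, Filter.Tendsto (fun δ : ℝ => (Literature.MathematicalPhysics.KineticTheory.HeatConduction.pinnedChain ω₂ lam β γ).totalCurrent (μ N (T + δ / 2) (T - δ / 2)) / δ) (nhdsWithin 0 {(0 : ℝ)}ᶜ) (nhds D)

/-- `FiniteResponseOfUnique` holds: proved by `Summit.AtomisticToContinuum.FouriersLaw.Theorems.FourierGreenKubo.finiteResponseOfUnique_holds`. -/
theorem FiniteResponseOfUnique_holds : FiniteResponseOfUnique := _root_.Summit.AtomisticToContinuum.FouriersLaw.Theorems.FourierGreenKubo.finiteResponseOfUnique_holds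

/-- item stmt-AtomisticToContinuum-0741 · support · rank 9 · closed · proved by Summit.AtomisticToContinuum.FouriersLaw.Theorems.nessUnique_proof (prover) · by planner
sources: CuneoEckmannHairerReyBellet2018, Carmona2007
[crux] UNIQUENESS OF THE WEAK STEADY STATE (the half of stmt-0706 not covered by the landed fact
Literature.MathematicalPhysics.KineticTheory.HeatConduction.CuneoEckmannHairerReyBellet2018_pinnedChain,
p3544): for pinnedChain ω₂ lam β γ (all > 0), every N and T_L, T_R > 0, any two measures in the weak
Fokker–Planck class IsSteadyState (probability, ∫ L f dμ = 0 for f ∈ C_c^∞, bond currents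
integrable) coincide. Print: uniqueness of the INVARIANT MEASURE of the Langevin semigroup
(CuneoEckmannHairerReyBellet2018 Thm 2.13(1): C1, C2, CA; Carmona2007 Thm 1.1(iii)); the item
additionally needs 'weak stationary probability solution of L*μ = 0 ⇒ P_t-invariant' for this
hypoelliptic L with cubic drift (Echeverría 1982 well-posed martingale problem on C_c^∞ +
non-explosion via e^{θH}; Bogachev–Krylov–Röckner–Shaposhnikov 2015 Ch. 5 is non-degenerate only) —
the FP-identification lemma is the formal crux. N = 0: PhaseSpace 0 is a point (unique probability
measure); N = 1: both baths on site 0, OU at temperature (T_L+T_R)/2. This is exactly the hypothesis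
of FiniteResponse and ThermodynamicLimit and, with the fact, gives clause (i) of FouriersLawFor. -/
@[route_item "route-AtomisticToContinuum-SelfDephasing"]
def NessUnique : Prop :=
  ∀ ω₂ lam β γ : ℝ, 0 < ω₂ → 0 < lam → 0 < β → 0 < γ → ∀ (N : ℕ) (T_L T_R : ℝ), 0 < T_L → 0 < T_R → ∀ μ ν : MeasureTheory.Measure (Literature.MathematicalPhysics.KineticTheory.HeatConduction.PhaseSpace N), (Literature.MathematicalPhysics.KineticTheory.HeatConduction.pinnedChain ω₂ lam β γ).IsSteadyState N T_L T_R μ → (Literature.MathematicalPhysics.KineticTheory.HeatConduction.pinnedChain ω₂ lam β γ).IsSteadyState N T_L T_R ν → μ = ν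

/-- `NessUnique` holds: proved by `Summit.AtomisticToContinuum.FouriersLaw.Theorems.nessUnique_proof`. -/
theorem NessUnique_holds : NessUnique := _root_.Summit.AtomisticToContinuum.FouriersLaw.Theorems.nessUnique_proof

/-- item stmt-AtomisticToContinuum-0743 · support · rank 9 · closed · proved by Summit.AtomisticToContinuum.FouriersLaw.Theorems.InfiniteVolumeSetup.infiniteVolumeSetup_proof (prover) · by planner
sources: LanfordLebowitzLieb1977, ButtaEtAl2007
[support] INFINITE-VOLUME SET-UP, split off GreenKubo on refuters' advice (g12-1/3/4: hidden
infrastructure load): for pinnedChain (all parameters > 0) and T > 0 there is a DLR Gibbs state μ_T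
(IsChainGibbsMeasure: existence via the 1-D transfer operator e^{-U/2T}e^{-V(q′−q)/T}e^{-U/2T},
Hilbert–Schmidt since U ≥ ω₂q²/2, or superstability/tightness) and an InfiniteChainDynamics D with
D.PreservesMeasure μ_T (μ_T-a.e. carrier, every φ_t measurable and measure preserving; requires a
carrier on which solutions are UNIQUE — LanfordLebowitzLieb1977 Thm 3 gives a.e. existence only, Thm
1/A4 fails for quartic V, Thm 2/4 uniqueness and invariance of μ_T under the infinite flow are not
vendored; nearest print for quartic U+V: Buttà–Caglioti–Di Ruzza–Marchioro 2007
doi:10.1007/s10955-007-9278-0, Marchioro–Pellegrinotti–Pulvirenti 1981). Print-level known modulo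
assembling these; a prerequisite of any GreenKubo witness. -/
@[route_item "route-AtomisticToContinuum-SelfDephasing"]
def InfiniteVolumeSetup : Prop :=
  ∀ ω₂ lam β γ : ℝ, 0 < ω₂ → 0 < lam → 0 < β → 0 < γ → ∀ T : ℝ, 0 < T → ∃ μ : MeasureTheory.Measure Literature.MathematicalPhysics.KineticTheory.HeatConduction.ChainConfig, (Literature.MathematicalPhysics.KineticTheory.HeatConduction.pinnedChain ω₂ lam β γ).IsChainGibbsMeasure T μ ∧ ∃ D : Literature.MathematicalPhysics.KineticTheory.HeatConduction.InfiniteChainDynamics (Literature.MathematicalPhysics.KineticTheory.HeatConduction.pinnedChain ω₂ lam β γ), D.PreservesMeasure μ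

/-- item stmt-AtomisticToContinuum-4126 · assembly · rank 1 · closed · moot by None · by planner
sources: BonettoLebowitzReyBellet2000, CuneoEckmannHairerReyBellet2018
[assembly] (fact CuneoEckmannHairerReyBellet2018_pinnedChain) → NessUnique → FiniteResponseOfUnique
→ OnePhononL2Decay → LifetimeControlsCurrent → NoSelfLocalization → ThermodynamicLimit →
FouriersLaw. -/
@[route_item "route-AtomisticToContinuum-SelfDephasing"]
def Assembly : Prop :=
  Literature.MathematicalPhysics.KineticTheory.HeatConduction.CuneoEckmannHairerReyBellet2018_pinnedChain → NessUnique → FiniteResponseOfUnique → OnePhononL2Decay → LifetimeControlsCurrent → NoSelfLocalization → ThermodynamicLimit → Literature.MathematicalPhysics.KineticTheory.HeatConduction.FouriersLaw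

end Summit.AtomisticToContinuum.FouriersLaw.Theses.SelfDephasing
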